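/-
Copyright (c) 2026. All rights reserved.
Released under Apache 2.0 license as described in the file LICENSE.
Authors: abc-iut cell, seat abc-iut-f-069 (gen 5; row «DPSC-NODAL-MODEL», residual HFix).
-/
import Literature.AnabelianGeometry.AbsoluteAnabelian.AbsTopII.DehnTwistLoopProp13vPrime
import Literature.GroupTheory.CombinatorialGroupTheory.FoxPathChains
import Mathlib.Topology.Algebra.ClopenNhdofOne
import Mathlib.Data.ZMod.Basic
import HarnessLib

/-!
# [AbsTopII] Prop 1.3 (v) at the nodal Dehn-twist datum: the fixed subgroup of the twist IS `Π_v` (HFix discharged)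

S. Mochizuki, *Topics in Absolute Anabelian Geometry II* [AbsTopII] (`MochizukiAbsTopII2013`), §1, Prop 1.3 (v)
p. 12: "`D_v = C_{Π_H}(I_v) = N_{Π_H}(I_v)` is commensurably terminal in `Π_H`".  At the nodal Dehn-twist datum
`dpsc i hi` (abc-iut-L4-t6 `DehnTwistLoopDatum`: `Π_𝔾 = F̂₂ = ⟨a,b⟩^`, one vertex `Π_v = ⟨b^Ẑ, a b^Ẑ a⁻¹⟩^`,
`Π_H = Π_I = F̂₂ ⋊_{shear^i} Ẑ`, `I_v = 1 ⋊ Ẑ`) the two equalities were typed MODULO ONE named input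
(abc-iut-f-069 gen 4, `DehnTwistLoopProp13v.prop13v_dpsc_of_fix`, `DehnTwistLoopProp13vPrime.prop_1_3_v'_dpsc_of_fix`)
«HFix: `∀ x n, 0 < n → (∀ k, shear^i(k^n) x = x) → x ∈ Π_v`» — the fixed subgroup of a non-trivial power of the
Dehn twist of `F̂₂` is the vertex group — whose `n = 1` case is EXACTLY clause 2 (`Dv_eq_normalizer_Iv_iff_fix`).

PROOF-ONLY (no definition), abc-iut-f-069 (gen 5).  **This file PROVES HFix**, so Prop 1.3 (v) (typed `Prop13v`,
F-0278) and its middle clause (typed `Prop_1_3_v'`, F-0300) hold at the nodal datum with NO hypothesis.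

ROUTE (a finite-quotient-uniform "Fox-calculus shadow" of the Bass–Serre argument «a `τ`-fixed vertex of the tree of
the HNN splitting `F̂₂ = Π_v *_{b ↦ aba⁻¹}` lies in the star of the base vertex»; classical ingredients only:
Lyndon–Schupp Ch. II §3 (Fox derivations, fundamental formula) [cite: LyndonSchupp2001, Ch. II §3], packaged in
`GroupTheory/CombinatorialGroupTheory/FoxPathChains.lean`).  Fix `x` with `shear^i(k^n) x = x` for all `k`, and an open
normal `V ≤ Π_I`; `G := Π_I / V` is finite.  Let `r` be the order of the image of the twist generator `(1, ι 1)`; with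
`κ := ι(1)^{rn}` the twist `σ := shear^i(κ)` FIXES `x` and `b`, moves `a ↦ a·b^M` (`M = rni ≥ 1`), and acts TRIVIALLY on
`G` (`φ ∘ σ = φ` for `φ : F̂₂ → Π_I → G`; in particular `B^M = 1`).  By the universal property of the profinite
completion there is a continuous Fox homomorphism `ψ : F̂₂ → W = (𝔽_ℓ^G × 𝔽_ℓ^G) ⋊ G` (`ℓ` a prime `> M`) with
`a ↦ ((𝟙,0),A)`, `b ↦ ((0,𝟙),B)`; its `G`-component is `φ`, its chain component `F` takes values in PATH CHAINS
(`∂F(g) = e_{φ g} - e_1`, a closed condition checked on the dense `F₂`), and `ψ ∘ σ = Θ ∘ ψ` for the chain substitution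
`Θ(f₁,f₂) = (f₁, f₂ + Σ_{j<M} ρ_{AB^j} f₁)` (two continuous homomorphisms agreeing on `a`, `b`: `ext_of_eta`).  Hence
`Σ_{j<M} ρ_{AB^j} f₁(x) = 0`, and the coset-sum test (`FoxChain.mem_of_fox_chain`, with `H :=` the image of `Π_v`,
which contains `B` and `ABA⁻¹`) gives `φ x ∈ φ(Π_v)`, i.e. `x ∈ Π_v · V`.  Finally `⋂_V Π_v·V = Π_v` (`Π_v` compact;
`ProfiniteGrp.exist_openNormalSubgroup_sub_open_nhds_of_one`).

* `mem_vertGp_of_forall_shearPow_pow_eq` — **HFix: `0 < i → 0 < n → (∀ k, shear^i(k^n) x = x) → x ∈ Π_v`**;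
  `forall_shearPow_eq_iff_mem_vertGp` — `Fix(shear^i(Ẑ)) = Π_v` exactly;
* `commensurator_range_inr_eq`, `normalizer_range_inr_eq` — `C_{Π_I}(1 ⋊ Ẑ) = N_{Π_I}(1 ⋊ Ẑ) = Π_v ⋊ Ẑ`, no hypothesis;
* `prop13v_dpsc_holds` — **the typed `DPSCData.Prop13v` (F-0278) HOLDS at `dpsc i hi`, no hypothesis**;
* `prop_1_3_v'_dpsc_holds` — **the typed `DPSCIndexData.Prop_1_3_v'` (F-0300) HOLDS at `dpsc i hi`, no hypothesis**;
* `Dv_eq_normalizer_Iv_dpsc` — `D_v = N_{Π_H}(I_v)` at the datum.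
HONEST FRAMING: classical profinite group theory (free profinite groups, finite quotients, Fox calculus) under OUR kernel
check, at a constructed model (constructed ≠ geometric); consistency evidence for the typed rows F-0278 / F-0300, not a
discharge of the facts at geometric data; nothing here bears on [IUTchIII] Cor 3.12; no side taken.
-/

noncomputable section

open scoped Pointwise

namespace Literature.AnabelianGeometry.AbsoluteAnabelian.AbsTopII.DehnTwist

open Literature.AnabelianGeometry.EtaleTheta.SettingModel
open Literature.GroupTheory.CombinatorialGroupTheory.FoxChain
open Function _root_.Topology

/-! ### Density: a closed subgroup of `F̂₂` containing `a`, `b` is everything -/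

/-- A closed subgroup of `F̂₂` containing the two free generators `η a`, `η b` is all of `F̂₂` (`η(F₂)` is dense and
generated by `a`, `b`). [cite: RibesZalesskii2010, Lemma 3.2.1] -/
theorem subgroup_eq_top_of_isClosed_of_gen_mem (D : Subgroup F₂hatT) (hD : IsClosed (D : Set F₂hatT))
    (h0 : genA ∈ D) (h1 : genB ∈ D) : D = ⊤ := by
  have hw : ∀ w : F₂, eta w ∈ D := by
    intro w
    refine FreeGroup.induction_on w ?_ ?_ ?_ ?_
    · rw [map_one]; exact D.one_mem
    · intro j
      fin_cases j
      · exact h0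
      · exact h1
    · intro j hj
      rw [map_inv]
      exact D.inv_mem hj
    · intro u v hu hv
      rw [map_mul]
      exact D.mul_mem hu hv
  rw [eq_top_iff]
  intro y _
  have hsub : (Set.univ : Set F₂hatT) ⊆ D := by
    rw [← denseRange_eta.closure_range]
    exact closure_minimal (Set.range_subset_iff.mpr hw) hD
  exact hsub (Set.mem_univ y)

/-! ### The fixed subgroup of the twist, finite quotient by finite quotient -/

section FixedSubgroup

variable {i : ℕ}

/-- **Finite-quotient form of HFix.**  If `x ∈ F̂₂` is fixed by `shear^i(k^n)` for every `k ∈ Ẑ` (`0 < i`, `0 < n`),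
then for every open normal subgroup `V` of `Π_I = F̂₂ ⋊_{shear^i} Ẑ` the image of `(x, 1)` in `Π_I / V` lies in the
image of `Π_v`: there is `p ∈ Π_v` with `(p,1)⁻¹ (x,1) ∈ V`.  (Fox homomorphism into `(𝔽_ℓ^G × 𝔽_ℓ^G) ⋊ G`,
`G = Π_I/V`, and the coset-sum test; see the module docstring.) [cite: MochizukiAbsTopII2013, Prop 1.3 (v) p.12] -/
theorem exists_mem_vertGp_inv_mul_mem (hi : 0 < i) {x : F₂hatT} {n : ℕ} (hn : 0 < n)
    (hfix : ∀ k : ZH, shearPow i (k ^ n) x = x) (V : OpenNormalSubgroup (Ext i)) :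
    ∃ p ∈ vertGp, (SemidirectProduct.inl p : Ext i)⁻¹ * SemidirectProduct.inl x ∈ V := by
  classical
  -- the finite quotient `Π_I / V`
  haveI : Finite (Ext i ⧸ V.toSubgroup) := Subgroup.quotient_finite_of_isOpen _ V.toOpenSubgroup.isOpen
  letI : Fintype (Ext i ⧸ V.toSubgroup) := Fintype.ofFinite _
  set π : Ext i →* Ext i ⧸ V.toSubgroup := QuotientGroup.mk' V.toSubgroup with hπ
  set φ : F₂hatT →* Ext i ⧸ V.toSubgroup := π.comp SemidirectProduct.inl with hφ
  set k₁ : ZH := iotaZ (Multiplicative.ofAdd 1) with hk₁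
  set r : ℕ := orderOf (π (SemidirectProduct.inr k₁)) with hr_def
  have hr : 0 < r := orderOf_pos _
  set κ : ZH := k₁ ^ (r * n) with hκ
  set M : ℕ := r * n * i with hM_def
  have hMpos : 0 < M := Nat.mul_pos (Nat.mul_pos hr hn) hi
  -- the twist `σ = shear^i(κ)` fixes `x` and `b`, and moves `a` to `a · b^M`
  have hσx : shearPow i κ x = x := by
    have h := hfix (k₁ ^ r)
    rwa [← pow_mul] at h
  have hσa : shearPow i κ genA = genA * genB ^ M := by
    show shearPow i κ (eta (FreeGroup.of 0)) = eta (FreeGroup.of 0) * eta (FreeGroup.of 1) ^ M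
    rw [shearPow_eta_zero, hκ, ← pow_mul, map_pow, hk₁, bPow_iotaZ_one]
  have hσb : shearPow i κ genB = genB := shearPow_eta_one i κ
  -- `φ ∘ σ = φ`: the image of `σ` in the finite quotient is trivial
  have ht : π (SemidirectProduct.inr κ) = 1 := by
    rw [hκ, map_pow, map_pow, pow_mul, hr_def, pow_orderOf_eq_one, one_pow]
  have hφσ : ∀ g, φ (shearPow i κ g) = φ g := by
    intro g
    show π (SemidirectProduct.inl (shearPow i κ g)) = π (SemidirectProduct.inl g)
    rw [SemidirectProduct.inl_aut, map_inv SemidirectProduct.inr, map_mul, map_mul, map_inv, ht, inv_one, mul_one,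
      one_mul]
  set A := φ genA with hA
  set B := φ genB with hB
  have hBM : B ^ M = 1 := by
    have h := hφσ genA
    rw [hσa, map_mul, map_pow] at h
    exact mul_left_cancel (h.trans (mul_one _).symm)
  -- a prime `ℓ > M`, so that `M ≠ 0` in `𝔽_ℓ`
  obtain ⟨ℓ, hMℓ, hℓ⟩ := Nat.exists_infinite_primes (M + 1)
  haveI : Fact ℓ.Prime := ⟨hℓ⟩
  have hMne : (M : ZMod ℓ) ≠ 0 := by
    rw [Ne, ZMod.natCast_eq_zero_iff]
    exact Nat.not_dvd_of_pos_of_lt hMpos (by omega)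
  -- the Fox group over the finite quotient (finite, discrete) and the Fox homomorphism `ψ`
  letI : TopologicalSpace (W (Ext i ⧸ V.toSubgroup) (ZMod ℓ)) := ⊥
  haveI : DiscreteTopology (W (Ext i ⧸ V.toSubgroup) (ZMod ℓ)) := ⟨rfl⟩
  haveI : Finite (W (Ext i ⧸ V.toSubgroup) (ZMod ℓ)) :=
    Finite.of_injective (fun w => (w.left, w.right))
      (fun w w' h => SemidirectProduct.ext (congrArg Prod.fst h) (congrArg Prod.snd h))
  obtain ⟨ψ, hψ⟩ := exists_continuousMonoidHom_extend F₂ (W (Ext i ⧸ V.toSubgroup) (ZMod ℓ))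
    (FreeGroup.lift ![wa A, wb B])
  have hψa : ψ genA = wa A := by
    show ψ (eta (FreeGroup.of 0)) = wa A
    rw [eta_apply, hψ, FreeGroup.lift_apply_of]
    rfl
  have hψb : ψ genB = wb B := by
    show ψ (eta (FreeGroup.of 1)) = wb B
    rw [eta_apply, hψ, FreeGroup.lift_apply_of]
    rfl
  -- (i) the `G`-component of `ψ` is `φ`
  let ρW : W (Ext i ⧸ V.toSubgroup) (ZMod ℓ) →ₜ* Ext i ⧸ V.toSubgroup :=
    ⟨SemidirectProduct.rightHom, continuous_of_discreteTopology⟩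
  let πc : Ext i →ₜ* Ext i ⧸ V.toSubgroup := ⟨π, QuotientGroup.continuous_mk⟩
  let inlc : F₂hatT →ₜ* Ext i := ⟨SemidirectProduct.inl, continuous_inl i⟩
  have hρψ : ρW.comp ψ = πc.comp inlc := by
    refine ext_of_eta ?_ ?_
    · show SemidirectProduct.rightHom (ψ (eta (FreeGroup.of 0))) = π (SemidirectProduct.inl (eta (FreeGroup.of 0)))
      rw [show ψ (eta (FreeGroup.of 0)) = wa A from hψa]
      rfl
    · show SemidirectProduct.rightHom (ψ (eta (FreeGroup.of 1))) = π (SemidirectProduct.inl (eta (FreeGroup.of 1)))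
      rw [show ψ (eta (FreeGroup.of 1)) = wb B from hψb]
      rfl
  have hright : ∀ g, (ψ g).right = φ g := fun g => DFunLike.congr_fun hρψ g
  -- (ii) every `ψ g` is a path chain: `∂ F(g) = e_{φ g} - e_1`
  have hpath : ∀ g, ψ g ∈ pathSub A B := by
    let D : Subgroup F₂hatT := (pathSub A B).comap ψ.toMonoidHom
    have hD : IsClosed (D : Set F₂hatT) := by
      change IsClosed (ψ ⁻¹' ((pathSub A B : Subgroup (W (Ext i ⧸ V.toSubgroup) (ZMod ℓ))) : Set _))
      exact (isClosed_discrete _).preimage ψ.continuous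
    have h0 : genA ∈ D := by
      show ψ genA ∈ pathSub A B
      rw [hψa]; exact wa_mem_pathSub A B
    have h1 : genB ∈ D := by
      show ψ genB ∈ pathSub A B
      rw [hψb]; exact wb_mem_pathSub A B
    have hDtop := subgroup_eq_top_of_isClosed_of_gen_mem D hD h0 h1
    intro g
    have hg : g ∈ D := hDtop ▸ Subgroup.mem_top g
    exact hg
  -- (iii) `ψ ∘ σ = Θ ∘ ψ`
  let Θc : W (Ext i ⧸ V.toSubgroup) (ZMod ℓ) →ₜ* W (Ext i ⧸ V.toSubgroup) (ZMod ℓ) :=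
    ⟨thetaHom A B M, continuous_of_discreteTopology⟩
  have hΘ : ψ.comp (shearEnd (κ ^ i)) = Θc.comp ψ := by
    refine ext_of_eta ?_ ?_
    · show ψ (shearPow i κ (eta (FreeGroup.of 0))) = thetaHom A B M (ψ (eta (FreeGroup.of 0)))
      rw [show shearPow i κ (eta (FreeGroup.of 0)) = genA * genB ^ M from hσa, map_mul, map_pow, hψa, hψb,
        thetaHom_wa A B M hBM]
    · show ψ (shearPow i κ (eta (FreeGroup.of 1))) = thetaHom A B M (ψ (eta (FreeGroup.of 1)))
      rw [show shearPow i κ (eta (FreeGroup.of 1)) = genB from hσb, hψb, thetaHom_wb]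
  have hfixW : thetaHom A B M (ψ x) = ψ x := by
    have h := DFunLike.congr_fun hΘ x
    change ψ (shearPow i κ x) = thetaHom A B M (ψ x) at h
    rw [hσx] at h
    exact h.symm
  -- the coset-sum test in the finite quotient
  have hsum := sum_rt_eq_zero_of_thetaHom_eq A B M (ψ x) hfixW
  have hbd : rt A (Multiplicative.toAdd (ψ x).left).1 - (Multiplicative.toAdd (ψ x).left).1 +
      (rt B (Multiplicative.toAdd (ψ x).left).2 - (Multiplicative.toAdd (ψ x).left).2) =
        e (φ x) - e 1 := by
    rw [← hright x]
    exact hpath x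
  let Hq : Subgroup (Ext i ⧸ V.toSubgroup) := vertGp.map φ
  have hBH : B ∈ Hq := Subgroup.mem_map_of_mem φ genB_mem_vertGp
  have hABH : A * B * A⁻¹ ∈ Hq := by
    rw [hA, hB, ← map_mul, ← map_inv, ← map_mul]
    exact Subgroup.mem_map_of_mem φ conj_genB_mem_vertGp
  have hX : φ x ∈ Hq := mem_of_fox_chain Hq hBH hABH hMne hbd hsum
  obtain ⟨p, hp, hpx⟩ := Subgroup.mem_map.mp hX
  exact ⟨p, hp, QuotientGroup.eq.mp hpx⟩

/-- **HFix — the fixed subgroup of a non-trivial power of the Dehn twist of `F̂₂` is the vertex group `Π_v`.**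
For `0 < i`, `0 < n`: if `shear^i(k^n) x = x` for all `k ∈ Ẑ`, then `x ∈ Π_v = ⟨b^Ẑ, a b^Ẑ a⁻¹⟩^`.  This is EXACTLY the
input «HFix» of `prop13v_dpsc_of_fix` / `prop_1_3_v'_dpsc_of_fix` (abc-iut-f-069 gen 4), now a theorem.
[cite: MochizukiAbsTopII2013, Prop 1.3 (v) p.12] -/
theorem mem_vertGp_of_forall_shearPow_pow_eq (hi : 0 < i) (x : F₂hatT) (n : ℕ) (hn : 0 < n)
    (hfix : ∀ k : ZH, shearPow i (k ^ n) x = x) : x ∈ vertGp := by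
  by_contra hx
  set S : Set (Ext i) :=
    (fun p : F₂hatT => (SemidirectProduct.inl p : Ext i)⁻¹ * SemidirectProduct.inl x) '' (vertGp : Set F₂hatT)
    with hS_def
  have hcl : IsClosed (vertGp : Set F₂hatT) := Subgroup.isClosed_topologicalClosure _
  have hS : IsCompact S :=
    hcl.isCompact.image (((continuous_inl i).inv).mul continuous_const)
  have h1S : (1 : Ext i) ∈ Sᶜ := by
    rintro ⟨p, hp, hpx⟩
    apply hx
    have h : (SemidirectProduct.inl p : Ext i) = SemidirectProduct.inl x := inv_mul_eq_one.mp hpx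
    rw [← SemidirectProduct.inl_injective h]
    exact hp
  obtain ⟨V, hV⟩ := ProfiniteGrp.exist_openNormalSubgroup_sub_open_nhds_of_one hS.isClosed.isOpen_compl h1S
  obtain ⟨p, hp, hpV⟩ := exists_mem_vertGp_inv_mul_mem hi hn hfix V
  exact hV hpV ⟨p, hp, rfl⟩

/-- **HFix in the exact shape consumed by the gen-4 files** (`∀ x n, 0 < n → (∀ k, shear^i(k^n) x = x) → x ∈ Π_v`).
[cite: MochizukiAbsTopII2013, Prop 1.3 (v) p.12] -/
theorem hfix_holds (hi : 0 < i) :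
    ∀ (x : F₂hatT) (n : ℕ), 0 < n → (∀ k : ZH, shearPow i (k ^ n) x = x) → x ∈ vertGp :=
  fun x n hn hfix => mem_vertGp_of_forall_shearPow_pow_eq hi x n hn hfix

/-- **`Fix(shear^i(Ẑ)) = Π_v` exactly** (`0 < i`): an element of `F̂₂` is fixed by every `shear^i(k)` iff it lies in
the vertex group (`⇐`: abc-iut-L4-t6 `shearPow_mem_vertGp`). [cite: MochizukiAbsTopII2013, Prop 1.3 (v) p.12] -/
theorem forall_shearPow_eq_iff_mem_vertGp (hi : 0 < i) (x : F₂hatT) :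
    (∀ k : ZH, shearPow i k x = x) ↔ x ∈ vertGp :=
  ⟨fun h => mem_vertGp_of_forall_shearPow_pow_eq hi x 1 Nat.one_pos (fun k => by rw [pow_one]; exact h k),
    fun hx k => shearPow_mem_vertGp i k x hx⟩

/-! ### Consequences: Prop 1.3 (v) at the nodal datum with NO hypothesis -/

/-- **`C_{Π_I}(1 ⋊ Ẑ) = Π_v ⋊ Ẑ`** (commensurator of the twist section), no hypothesis (`0 < i`).
[cite: MochizukiAbsTopII2013, Prop 1.3 (v) p.12] -/
theorem commensurator_range_inr_eq (hi : 0 < i) :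
    Subgroup.Commensurable.commensurator ((SemidirectProduct.inr : ZH →* Ext i).range) =
      vertGp.map (SemidirectProduct.inl : F₂hatT →* Ext i) ⊔ (SemidirectProduct.inr : ZH →* Ext i).range :=
  commensurator_range_inr_eq_of_fix i (hfix_holds hi)

/-- **`N_{Π_I}(1 ⋊ Ẑ) = Π_v ⋊ Ẑ`**, no hypothesis (`0 < i`). [cite: MochizukiAbsTopII2013, Prop 1.3 (v) p.12] -/
theorem normalizer_range_inr_eq (hi : 0 < i) :
    Subgroup.normalizer (((SemidirectProduct.inr : ZH →* Ext i).range : Subgroup (Ext i)) : Set (Ext i)) =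
      vertGp.map (SemidirectProduct.inl : F₂hatT →* Ext i) ⊔ (SemidirectProduct.inr : ZH →* Ext i).range :=
  normalizer_range_inr_eq_of_fix i (hfix_holds hi)

variable (hi : 0 < i)

/-- **[AbsTopII] Prop 1.3 (v) — the typed `DPSCData.Prop13v` (F-0278) — HOLDS at the nodal Dehn-twist datum
`dpsc i hi`, with NO hypothesis** (all five clauses: `D_v = C_{Π_H}(I_v) = N_{Π_H}(I_v)` commensurably terminal in
`Π_H`, `D_v ∩ Π_𝔾 = Π_v` commensurably terminal in `Π_𝔾`). [cite: MochizukiAbsTopII2013, Prop 1.3 (v) p.12] -/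
theorem prop13v_dpsc_holds : (dpsc i hi).toDPSCData.Prop13v :=
  prop13v_dpsc_of_fix hi (hfix_holds hi)

/-- **[AbsTopII] Prop 1.3 (v) middle clause — the typed `DPSCIndexData.Prop_1_3_v'` (F-0300) — HOLDS at the nodal
Dehn-twist datum `dpsc i hi`, with NO hypothesis.** [cite: MochizukiAbsTopII2013, Prop 1.3 (v) p.12] -/
theorem prop_1_3_v'_dpsc_holds :
    Literature.AnabelianGeometry.AbsoluteAnabelian.AbsTopII.DPSCIndexData.Prop_1_3_v' (dpsc i hi) :=
  prop_1_3_v'_dpsc_of_fix hi (hfix_holds hi)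

/-- **`D_v = N_{Π_H}(I_v)` at `dpsc i hi`**, no hypothesis. [cite: MochizukiAbsTopII2013, Prop 1.3 (v) p.12] -/
theorem Dv_eq_normalizer_Iv_dpsc (v : (dpsc i hi).Vert) :
    (dpsc i hi).Dv v = Subgroup.normalizer (((dpsc i hi).Iv v : Subgroup (dpsc i hi).PiH) : Set (dpsc i hi).PiH) :=
  (Dv_eq_normalizer_Iv_iff_fix hi v).mpr fun x hx => (forall_shearPow_eq_iff_mem_vertGp hi x).mp hx

/-- **One nodal datum where the typed (i), (ii), (ii′), (iii)₁, (v), (v′), (vi), (vii), (ix) of [AbsTopII] Prop 1.3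
hold together with no hypothesis** (conjunction of the landed `_dpsc_holds` theorems at `dpsc 1`).
[cite: MochizukiAbsTopII2013, Prop 1.3 p.11] -/
theorem exists_nodal_model_prop13v :
    ∃ X : Literature.AnabelianGeometry.AbsoluteAnabelian.AbsTopII.DPSCIndexData.{0},
      Nonempty X.Node ∧ X.toDPSCData.Prop13v ∧
        Literature.AnabelianGeometry.AbsoluteAnabelian.AbsTopII.DPSCIndexData.Prop_1_3_v' X :=
  ⟨dpsc 1 Nat.one_pos, dpsc_node_nonempty 1 Nat.one_pos, prop13v_dpsc_holds Nat.one_pos,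
    prop_1_3_v'_dpsc_holds Nat.one_pos⟩

end FixedSubgroup

end Literature.AnabelianGeometry.AbsoluteAnabelian.AbsTopII.DehnTwist

end
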